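import Summits.QuantumFields.YangMills.Theorems.BalabanLadderIRcofSchurFejerSplit
import Mathlib.MeasureTheory.Group.Integral
import Mathlib.Topology.Order.Compact
import HarnessLib

/-!
# Schur–Fejér splitting — §5a–5b: unitary trace maxima and the general Laplace RATIO lemma

Ideator `ym-ir-idea-22` g4 · crux `IRcof` (stmt-QuantumFields-26930) · row 47 stub S2ᵛ; source `Cruxes/IRcof/Lines/equipartition_seam_SchurFejerCore.lean`
rev 6 §5 (5a)(5b), extracted VERBATIM by the custody LEAD ym-ir-line-ab-p1 g7 (LEAD LANE PROTOCOL (b); LAND-ASK #3, critic ym-ir-crit-3 g4's word) as the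
first of TWO files (400-line cap): this one = (5b) ★ `laplace_ratio_tendsto_zero` ((5a), a unitary matrix with `Re tr U = N` is `1`, is ALREADY in the tree:
`Literature.Barriers.QuantumFields.re_trace_le_of_mem_unitaryGroup` ∕ `eq_one_of_re_trace_eq` in `DiscreteSubgroupFreezing.lean` — gate `dedup.landed`; cited by name in the sequel) — compact space, finite measure charging opens, `F`, `f ≥ 0` continuous,
`f = 0` at the maxima of `F` ⇒ `∫ e^{βF} f ∕ ∫ e^{βF} → 0` as `β → ∞`.  The mass identity ∕ domination ∕ `splitVanishingAt_cyclic` (5c–5e) are the sequel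
`Theorems/BalabanLadderIRcofSchurFejerSplitVanishing.lean`.  Same namespace `…EquipartitionSeam.SchurFejer`; proof lane (no definition).
HONEST: analysis lemma + matrix fact for one stub of one registered line (row 47, mechanism 0); width 0; YM mass gap (Clay) NOT proved; `IRcof` 0∕1;
R4 = `BalabanLadder.UV` only.
-/

set_option autoImplicit false

noncomputable section

open Finset Complex

namespace Summit.QuantumFields.YangMills.Cruxes.IRcof.EquipartitionSeam.SchurFejer

section Laplace

open MeasureTheory Filter Topology
open Literature.MathematicalPhysics.QuantumFieldTheory Literature.MathematicalPhysics.QuantumLattice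
open Summit.QuantumFields.YangMills.Theorems.NonSimplyConnectedLatticeGap

/-- **Laplace concentration (ratio form).**  On a compact space with a finite measure charging open
sets, for continuous `F` and continuous `f ≥ 0` vanishing at every maximum point of `F`,
`∫ e^{β F} f / ∫ e^{β F} → 0` as `β → ∞`. [folklore] -/
theorem laplace_ratio_tendsto_zero {X : Type*} [TopologicalSpace X] [CompactSpace X] [Nonempty X]
    [MeasurableSpace X] [OpensMeasurableSpace X] (μ : Measure X) [IsFiniteMeasure μ]
    [μ.IsOpenPosMeasure] {F f : X → ℝ} (hF : Continuous F) (hf : Continuous f)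
    (hf0 : ∀ x, 0 ≤ f x) (hfz : ∀ x, (∀ y, F y ≤ F x) → f x = 0) :
    Tendsto (fun β : ℝ => (∫ x, Real.exp (β * F x) * f x ∂μ) / ∫ x, Real.exp (β * F x) ∂μ)
      atTop (𝓝 0) := by
  -- global maxima of `F` and of `f`
  obtain ⟨x₀, -, hx₀⟩ := isCompact_univ.exists_isMaxOn Set.univ_nonempty hF.continuousOn
  have hM : ∀ y, F y ≤ F x₀ := fun y => hx₀ (Set.mem_univ y)
  obtain ⟨x₂, -, hx₂⟩ := isCompact_univ.exists_isMaxOn Set.univ_nonempty hf.continuousOn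
  have hB : ∀ y, f y ≤ f x₂ := fun y => hx₂ (Set.mem_univ y)
  set M := F x₀ with hMdef
  set B := f x₂ with hBdef
  have hB0 : 0 ≤ B := hf0 x₂
  -- integrability of the continuous integrands
  have hEi : ∀ β : ℝ, Integrable (fun x => Real.exp (β * F x)) μ := fun β =>
    ((hF.const_mul β).rexp).integrable_of_hasCompactSupport (HasCompactSupport.of_compactSpace _)
  have hEfi : ∀ β : ℝ, Integrable (fun x => Real.exp (β * F x) * f x) μ := fun β =>
    (((hF.const_mul β).rexp).mul hf).integrable_of_hasCompactSupport
      (HasCompactSupport.of_compactSpace _)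
  rw [Metric.tendsto_atTop]
  intro ε hε
  set ε' := ε / 2 with hε'
  have hε'0 : 0 < ε' := by positivity
  -- separation: away from `{f < ε'}` the function `F` stays below some `m < M`
  obtain ⟨m, hmM, hm⟩ : ∃ m : ℝ, m < M ∧ ∀ x, ε' ≤ f x → F x ≤ m := by
    by_cases hK : ({x | ε' ≤ f x} : Set X).Nonempty
    · have hKc : IsCompact {x | ε' ≤ f x} := (isClosed_le continuous_const hf).isCompact
      obtain ⟨x₁, hx₁K, hx₁⟩ := hKc.exists_isMaxOn hK hF.continuousOn
      refine ⟨F x₁, ?_, fun x hx => hx₁ hx⟩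
      by_contra hlt
      have hge : M ≤ F x₁ := not_lt.1 hlt
      have h0 := hfz x₁ fun y => (hM y).trans hge
      have hx₁K' : ε' ≤ f x₁ := hx₁K
      linarith
    · exact ⟨M - 1, by linarith, fun x hx => absurd ⟨x, hx⟩ hK⟩
  set δ := M - m with hδ
  have hδ0 : 0 < δ := by linarith
  have hm' : m = M - δ := by rw [hδ]; ring
  -- the open neighbourhood `V = {M - δ/2 < F}` of `x₀`, charged by `μ`
  set V : Set X := {x | M - δ / 2 < F x} with hV
  have hVo : IsOpen V := isOpen_lt continuous_const hF
  have hx₀V : x₀ ∈ V := by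
    show M - δ / 2 < F x₀
    linarith
  have hVpos : 0 < μ.real V :=
    ENNReal.toReal_pos (hVo.measure_pos μ ⟨x₀, hx₀V⟩).ne' (measure_ne_top μ V)
  -- the decaying error constant
  set C := B * μ.real Set.univ / μ.real V with hC
  have hC0 : 0 ≤ C := by positivity
  have hCV : C * μ.real V = B * μ.real Set.univ := by
    rw [hC]
    field_simp
  have hg : Tendsto (fun β : ℝ => C * Real.exp (-(δ / 2 * β))) atTop (𝓝 0) := by
    have h1 : Tendsto (fun β : ℝ => δ / 2 * β) atTop atTop :=
      tendsto_id.const_mul_atTop (by positivity)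
    have h2 := Real.tendsto_exp_neg_atTop_nhds_zero.comp h1
    simpa using h2.const_mul C
  obtain ⟨N, hN⟩ := (Metric.tendsto_atTop.1 hg) ε' hε'0
  refine ⟨max N 0, fun β hβ => ?_⟩
  have hβN : N ≤ β := le_trans (le_max_left _ _) hβ
  have hβ0 : 0 ≤ β := le_trans (le_max_right _ _) hβ
  have hgβ : C * Real.exp (-(δ / 2 * β)) < ε' := by
    have h := hN β hβN
    rw [Real.dist_eq, sub_zero, abs_of_nonneg (by positivity)] at h
    exact h
  -- numerator: pointwise `e^{βF} f ≤ ε' e^{βF} + e^{βm} B`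
  have hpt : ∀ x, Real.exp (β * F x) * f x ≤
      ε' * Real.exp (β * F x) + Real.exp (β * m) * B := by
    intro x
    have hA : 0 ≤ ε' * Real.exp (β * F x) := mul_nonneg hε'0.le (Real.exp_pos _).le
    have hB' : 0 ≤ Real.exp (β * m) * B := mul_nonneg (Real.exp_pos _).le hB0
    by_cases hx : ε' ≤ f x
    · have h1 : Real.exp (β * F x) ≤ Real.exp (β * m) :=
        Real.exp_le_exp.2 (mul_le_mul_of_nonneg_left (hm x hx) hβ0)
      have h2 : Real.exp (β * F x) * f x ≤ Real.exp (β * m) * B :=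
        mul_le_mul h1 (hB x) (hf0 x) (Real.exp_pos _).le
      linarith
    · have h2 : Real.exp (β * F x) * f x ≤ Real.exp (β * F x) * ε' :=
        mul_le_mul_of_nonneg_left (not_le.1 hx).le (Real.exp_pos _).le
      have h3 : Real.exp (β * F x) * ε' = ε' * Real.exp (β * F x) := mul_comm _ _
      linarith
  have hnum : ∫ x, Real.exp (β * F x) * f x ∂μ ≤
      ε' * ∫ x, Real.exp (β * F x) ∂μ + Real.exp (β * m) * B * μ.real Set.univ :=
    calc ∫ x, Real.exp (β * F x) * f x ∂μ
        ≤ ∫ x, (ε' * Real.exp (β * F x) + Real.exp (β * m) * B) ∂μ :=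
          integral_mono (hEfi β) (((hEi β).const_mul ε').add (integrable_const _)) hpt
      _ = ε' * ∫ x, Real.exp (β * F x) ∂μ + Real.exp (β * m) * B * μ.real Set.univ := by
          rw [integral_add ((hEi β).const_mul ε') (integrable_const _), integral_const_mul,
            integral_const, smul_eq_mul]
          ring
  -- denominator: `e^{β (M - δ/2)} μ(V) ≤ ∫ e^{βF}`
  have hden : Real.exp (β * (M - δ / 2)) * μ.real V ≤ ∫ x, Real.exp (β * F x) ∂μ :=
    calc Real.exp (β * (M - δ / 2)) * μ.real V = ∫ _ in V, Real.exp (β * (M - δ / 2)) ∂μ := by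
          rw [setIntegral_const, smul_eq_mul, mul_comm]
      _ ≤ ∫ x in V, Real.exp (β * F x) ∂μ := by
          refine setIntegral_mono_on integrableOn_const (hEi β).integrableOn hVo.measurableSet
            fun x hx => ?_
          exact Real.exp_le_exp.2 (mul_le_mul_of_nonneg_left (le_of_lt hx) hβ0)
      _ ≤ ∫ x, Real.exp (β * F x) ∂μ :=
          setIntegral_le_integral (hEi β) (Eventually.of_forall fun x => (Real.exp_pos _).le)
  have hden0 : 0 < ∫ x, Real.exp (β * F x) ∂μ :=
    lt_of_lt_of_le (mul_pos (Real.exp_pos _) hVpos) hden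
  have hnum0 : 0 ≤ ∫ x, Real.exp (β * F x) * f x ∂μ :=
    integral_nonneg fun x => mul_nonneg (Real.exp_pos _).le (hf0 x)
  -- the error term against the denominator
  have hexp : Real.exp (-(δ / 2 * β)) * Real.exp (β * (M - δ / 2)) = Real.exp (β * m) := by
    rw [← Real.exp_add, hm']
    congr 1
    ring
  have hkey : Real.exp (β * m) * B * μ.real Set.univ ≤
      C * Real.exp (-(δ / 2 * β)) * ∫ x, Real.exp (β * F x) ∂μ :=
    calc Real.exp (β * m) * B * μ.real Set.univ
        = (C * μ.real V) * (Real.exp (-(δ / 2 * β)) * Real.exp (β * (M - δ / 2))) := by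
          rw [hCV, hexp]
          ring
      _ = C * Real.exp (-(δ / 2 * β)) * (Real.exp (β * (M - δ / 2)) * μ.real V) := by ring
      _ ≤ C * Real.exp (-(δ / 2 * β)) * ∫ x, Real.exp (β * F x) ∂μ :=
          mul_le_mul_of_nonneg_left hden (by positivity)
  have hratio : (∫ x, Real.exp (β * F x) * f x ∂μ) / (∫ x, Real.exp (β * F x) ∂μ) ≤
      ε' + C * Real.exp (-(δ / 2 * β)) := by
    rw [div_le_iff₀ hden0]
    have e : (ε' + C * Real.exp (-(δ / 2 * β))) * ∫ x, Real.exp (β * F x) ∂μ =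
        ε' * ∫ x, Real.exp (β * F x) ∂μ +
          C * Real.exp (-(δ / 2 * β)) * ∫ x, Real.exp (β * F x) ∂μ := by ring
    rw [e]
    linarith
  rw [Real.dist_eq, sub_zero, abs_of_nonneg (div_nonneg hnum0 hden0.le)]
  linarith


end Laplace

end Summit.QuantumFields.YangMills.Cruxes.IRcof.EquipartitionSeam.SchurFejer

end
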